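import Mathlib
import Summits.NavierStokesRegularity.FluidComputer.TransportCommutatorLattice
import HarnessLib

/-!
# The transport term on the lattice Sobolev scale, II: the skew identity and the `H²` transport form (instab g16, cell `ns-blowup`, 2026-08-27)

HONEST FRAMING (human ruling D-0035): nothing here is a claim about Navier–Stokes blow-up.
WHAT THIS IS NOT: not NS evidence — one algebraic identity and one inequality for coefficient
families on `ℤ^d`, Mathlib + the tree's `Lattice*` toolkit + part I
(`TransportCommutatorLattice.lean`). No flow, operator, set `W` or certificate is constructed.

PURPOSE. The `htransport`-shaped input of condition (C2) of the R-β chain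
(`GalerkinOneSidedLipschitz.galerkin_oneSided_uniform_transport`, p472299; `HOME/instab/BETA2-SPEC.md`
§5): advection by a real divergence-free field is skew in `L²` and costs one commutator in `H²`.
With `T_y G := ∑_j y_j ⋆ ∂_j G` (the Fourier coefficients of `(y·∇)G`; `y_j ⋆` = `Lattice.conv
(Lattice.scal y_j)`, `∂_j` = `Lattice.freqDeriv j`, pairing `Lattice.pairing u v = ∑_k ⟪u k, v k⟫`):

* §1 `adjSymb_scal_of_real` — reality `y(−p) = conj y(p)` makes the scalar multiplier self-adjoint;
  `pairing_conv_freqDeriv_eq` — `⟨y ⋆ ∂_j G, G⟩ = −⟨G, (∂_j y) ⋆ G⟩ − conj ⟨y ⋆ ∂_j G, G⟩`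
  (adjoint of a multiplier `Lattice.pairing_conv_left`, skew-adjointness `Lattice.pairing_freqDeriv_left`,
  Leibniz `Lattice.freqDeriv_conv`); **`pairing_transport_add_conj_eq_zero`** /
  `re_pairing_transport_eq_zero` — for `y` rapidly decreasing, real and divergence-free
  (`∑_j ∂_j y_j = 0`) and `G ∈ H¹`: `Re ⟨T_y G, G⟩ = 0` (Fourier side of
  `∫ (y·∇)G · G̅ + c.c. = −∫ (div y)|G|² = 0`).
* §2 **`abs_re_pairing_wmul_two_transport_le`** (and the primed `eNormSq` form): for such `y` and
  `u ∈ H³` (finiteness only), `|Re ⟨Λ² T_y u, Λ² u⟩| ≤ 6π (∑_j A₂(y_j)) ‖u‖₂²` — decomposition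
  `Λ²(y_j ⋆ ∂_j u) = y_j ⋆ ∂_j(Λ² u) + [Λ², y_j ⋆] ∂_j u`, the skew identity with `G = Λ² u`, the
  commutator bound `TransportCommutatorLattice.eNorm_wmul_two_conv_sub_le` and Cauchy–Schwarz
  `Lattice.norm_pairing_le`. This is `htransport` with `κ = 6π·sup_{y ∈ W} ∑_j A₂(y_j)`; both signs
  are covered (absolute value), so the sign convention of the nonlinearity is immaterial; with
  `y = U` (the host, finitely many modes) it is the transport half of `hA`.

* §3 `pairing_apply_eq_of_isSelfAdjoint`, `eNormSq_apply_le_of_opNorm_le_one` — a modewise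
  self-adjoint family fixing `v` drops out of `⟨Π u, v⟩`, and a modewise contraction does not
  increase any `H^s` norm: the Leray symbol disappears from `htransport` and is harmless in `hfirst`.

HYPOTHESES, honestly: the advecting field is RAPIDLY DECREASING (finitely supported fields — every
Galerkin level — and the ABC host qualify; a general element of a polynomial box does not: for those
the identity holds by the same proof from weighted-`ℓ¹` finiteness, not typed here); the advected
field needs `H¹` (skew identity) resp. `H³` (transport form) only for the convergence of the sums —
the BOUND is in `H²`. The Leray projection enters only through §3 (abstract modewise family; the
concrete symbol `1 − k ⊗ k/|k|²` is instantiated with the `lp` phase space, not here).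

TREE SEARCH: torus side `Torus.integral_inner_convect_self_eq_zero` (the transport identity in
physical space, `TorusCommutatorEstimate`'s glue) and `Torus.integral_sum_mul_mul_partialDeriv_vecMollify_eq_zero`
— physical-space statements for smooth fields, not imported; lattice side: no transport/skew lemma
(`lean search 'pairing_conv|skew|transport'`): the parts `pairing_conv_left`, `pairing_freqDeriv_left`,
`freqDeriv_conv` exist and are composed here. Nothing restated.
-/

noncomputable section

namespace Summit.NavierStokesRegularity.FluidComputer.TransportSkewLattice

open Finset
open Literature.Analysis.FunctionSpaces Literature.Analysis.FunctionSpaces.Lattice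
open Literature.Analysis.FunctionSpaces.Torus
open Summit.NavierStokesRegularity.FluidComputer.TransportCommutatorLattice
open scoped ENNReal NNReal InnerProductSpace ComplexConjugate

variable {d : Type*} [Fintype d]

/-! ## §1 The skew identity of transport: `⟨(y·∇)G, G⟩ + conj ⟨(y·∇)G, G⟩ = 0` for a real divergence-free `y` -/

section Skew

variable {V : Type*} [NormedAddCommGroup V] [InnerProductSpace ℂ V] [CompleteSpace V]

omit [Fintype d] in
/-- **Reality makes a scalar multiplier self-adjoint**: if `χ(−p) = conj χ(p)` (the Fourier
coefficients of a REAL function) then the adjoint symbol of `χ • 1` is `χ • 1`. -/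
theorem adjSymb_scal_of_real {χ : (d → ℤ) → ℂ} (hχ : ∀ p, χ (-p) = conj (χ p)) :
    adjSymb (scal χ : (d → ℤ) → (V →L[ℂ] V)) = scal χ := by
  funext k
  rw [adjSymb_apply, scal_apply, scal_apply, hχ, map_smulₛₗ ContinuousLinearMap.adjoint,
    ContinuousLinearMap.one_def, ContinuousLinearMap.adjoint_id, starRingEnd_self_apply]

omit [Fintype d] [CompleteSpace V] in
/-- Finite sums in the left slot of the pairing, given termwise convergence. -/
theorem pairing_finset_sum_left_of_summable {ι : Type*} (F : Finset ι) {u : ι → (d → ℤ) → V}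
    {v : (d → ℤ) → V} (h : ∀ i ∈ F, Summable fun k => ⟪u i k, v k⟫_ℂ) :
    pairing (∑ i ∈ F, u i) v = ∑ i ∈ F, pairing (u i) v := by
  classical
  induction F using Finset.induction_on with
  | empty => simp [pairing]
  | insert i F hi ih =>
      have hF : Summable fun k => ⟪(∑ i ∈ F, u i) k, v k⟫_ℂ := by
        have := summable_sum (s := F) fun i hi' => h i (Finset.mem_insert_of_mem hi')
        refine this.congr fun k => ?_
        rw [Finset.sum_apply, sum_inner]
      rw [Finset.sum_insert hi, Finset.sum_insert hi,
        pairing_add_left (h i (Finset.mem_insert_self i F)) hF,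
        ih fun k hk => h k (Finset.mem_insert_of_mem hk)]

omit [Fintype d] [CompleteSpace V] in
/-- Finite sums in the right slot of the pairing, given termwise convergence. -/
theorem pairing_finset_sum_right_of_summable {ι : Type*} (F : Finset ι) {u : (d → ℤ) → V}
    {v : ι → (d → ℤ) → V} (h : ∀ i ∈ F, Summable fun k => ⟪u k, v i k⟫_ℂ) :
    pairing u (∑ i ∈ F, v i) = ∑ i ∈ F, pairing u (v i) := by
  classical
  induction F using Finset.induction_on with
  | empty => simp [pairing]
  | insert i F hi ih =>
      have hF : Summable fun k => ⟪u k, (∑ i ∈ F, v i) k⟫_ℂ := by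
        have := summable_sum (s := F) fun i hi' => h i (Finset.mem_insert_of_mem hi')
        refine this.congr fun k => ?_
        rw [Finset.sum_apply, inner_sum]
      rw [Finset.sum_insert hi, Finset.sum_insert hi,
        pairing_add_right (h i (Finset.mem_insert_self i F)) hF,
        ih fun k hk => h k (Finset.mem_insert_of_mem hk)]

omit [Fintype d] [CompleteSpace V] in
/-- Scalar symbols are finitely additive: `scal (∑ χᵢ) = ∑ scal χᵢ`. -/
theorem scal_finset_sum {ι : Type*} (F : Finset ι) (χ : ι → (d → ℤ) → ℂ) :
    (scal (∑ i ∈ F, χ i) : (d → ℤ) → (V →L[ℂ] V)) = ∑ i ∈ F, scal (χ i) := by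
  funext k
  simp only [scal_apply, Finset.sum_apply, Finset.sum_smul]

/-- **The divergence of the advecting field is the obstruction to skewness**: for a rapidly
decreasing REAL vector coefficient family `y = (y_j)_j` (`y_j(−p) = conj y_j(p)`) and `G ∈ H¹`,
with the transport family `T_y G := ∑_j y_j ⋆ ∂_j G` (the coefficients of `(y·∇)G`),
`⟨y_j ⋆ ∂_j G, G⟩ = −⟨G, (∂_j y_j) ⋆ G⟩ − conj ⟨y_j ⋆ ∂_j G, G⟩` for each `j`
(adjoint of a real multiplier `Lattice.pairing_conv_left`, skew-adjointness of `∂_j`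
`Lattice.pairing_freqDeriv_left`, Leibniz `Lattice.freqDeriv_conv`). -/
theorem pairing_conv_freqDeriv_eq (y : (d → ℤ) → ℂ) (hy : RapidDecay y)
    (hreal : ∀ p, y (-p) = conj (y p)) (j : d) {G : (d → ℤ) → V} (hG : eNormSq 1 G < ∞) :
    pairing (conv (scal y) (freqDeriv j G)) G =
      -pairing G (conv (scal (freqDeriv j y)) G) - conj (pairing (conv (scal y) (freqDeriv j G)) G) := by
  have ha : RapidDecay (scal y : (d → ℤ) → (V →L[ℂ] V)) := hy.scal
  have hG0 : eNormSq 0 G < ∞ := (eNormSq_mono zero_le_one G).trans_lt hG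
  have hG0' : eNormSq (-0) G < ∞ := by rw [neg_zero]; exact hG0
  have hGt : Tempered G := ⟨0, hG0⟩
  have hdG : eNormSq 0 (freqDeriv j G) < ∞ :=
    (eNormSq_freqDeriv_le 0 j G).trans_lt (ENNReal.mul_lt_top ENNReal.ofReal_lt_top (by rwa [zero_add]))
  -- summability of the two pairings on the right
  have hs1 : Summable fun k => ⟪G k, conv (scal (freqDeriv j y) : (d → ℤ) → (V →L[ℂ] V)) G k⟫_ℂ :=
    summable_inner hG0 (by rw [neg_zero]; exact eNormSq_conv_lt_top (hy.deriv j).scal hG0)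
  have hs2 : Summable fun k => ⟪G k, conv (scal y) (freqDeriv j G) k⟫_ℂ :=
    summable_inner hG0 (by rw [neg_zero]; exact eNormSq_conv_lt_top ha hdG)
  calc pairing (conv (scal y) (freqDeriv j G)) G
      = pairing (freqDeriv j G) (conv (adjSymb (scal y)) G) := pairing_conv_left ha hdG hG0'
    _ = pairing (freqDeriv j G) (conv (scal y) G) := by rw [adjSymb_scal_of_real hreal]
    _ = -pairing G (freqDeriv j (conv (scal y) G)) := pairing_freqDeriv_left j G _
    _ = -pairing G (conv (scal (freqDeriv j y)) G + conv (scal y) (freqDeriv j G)) := by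
        rw [freqDeriv_conv ha hGt j, freqDeriv_scal]
    _ = -(pairing G (conv (scal (freqDeriv j y)) G) + pairing G (conv (scal y) (freqDeriv j G))) := by
        rw [pairing_add_right hs1 hs2]
    _ = _ := by rw [pairing_comm (conv (scal y) (freqDeriv j G)) G]; ring

/-- **The skew identity of transport on the lattice** (Fourier side of `∫ ((y·∇)G)·G̅ + c.c. =
−∫ (div y)|G|² = 0`): for a rapidly decreasing, REAL (`y_j(−p) = conj y_j(p)`) and DIVERGENCE-FREE
(`∑_j ∂_j y_j = 0`) coefficient vector `y` and every `G ∈ H¹`,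
`⟨T_y G, G⟩ + conj ⟨T_y G, G⟩ = 0`, `T_y G = ∑_j y_j ⋆ ∂_j G`. The advected family `G` is
vector-valued (values in any complex Hilbert space `V`; the scalar symbol `y_j • 1` acts
diagonally), so one statement covers every component count. -/
theorem pairing_transport_add_conj_eq_zero (y : d → (d → ℤ) → ℂ) (hy : ∀ j, RapidDecay (y j))
    (hreal : ∀ j p, y j (-p) = conj (y j p)) (hdiv : ∑ j, freqDeriv j (y j) = 0)
    {G : (d → ℤ) → V} (hG : eNormSq 1 G < ∞) :
    pairing (∑ j, conv (scal (y j)) (freqDeriv j G)) G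
      + conj (pairing (∑ j, conv (scal (y j)) (freqDeriv j G)) G) = 0 := by
  have hG0 : eNormSq 0 G < ∞ := (eNormSq_mono zero_le_one G).trans_lt hG
  have hG0' : eNormSq (-0) G < ∞ := by rw [neg_zero]; exact hG0
  have hGt : Tempered G := ⟨0, hG0⟩
  have hdG : ∀ j, eNormSq 0 (freqDeriv j G) < ∞ := fun j =>
    (eNormSq_freqDeriv_le 0 j G).trans_lt (ENNReal.mul_lt_top ENNReal.ofReal_lt_top (by rwa [zero_add]))
  have ha : ∀ j, RapidDecay (scal (y j) : (d → ℤ) → (V →L[ℂ] V)) := fun j => (hy j).scal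
  -- split the pairing over `j`
  have hsum : pairing (∑ j, conv (scal (y j)) (freqDeriv j G)) G =
      ∑ j, pairing (conv (scal (y j)) (freqDeriv j G)) G :=
    pairing_finset_sum_left_of_summable _ fun j _ =>
      summable_inner (eNormSq_conv_lt_top (ha j) (hdG j)) hG0'
  -- the divergence term vanishes
  have hdiv' : ∑ j, pairing G (conv (scal (freqDeriv j (y j)) : (d → ℤ) → (V →L[ℂ] V)) G) = 0 := by
    rw [← pairing_finset_sum_right_of_summable _ fun j _ => summable_inner hG0
      (by rw [neg_zero]; exact eNormSq_conv_lt_top ((hy j).deriv j).scal hG0),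
      ← finset_sum_conv (a := fun j => (scal (freqDeriv j (y j)) : (d → ℤ) → (V →L[ℂ] V))) _
        (fun j _ => ((hy j).deriv j).scal) hGt, ← scal_finset_sum, hdiv]
    have h0 : (scal (0 : (d → ℤ) → ℂ) : (d → ℤ) → (V →L[ℂ] V)) = 0 := by
      funext k; simp only [scal_apply, Pi.zero_apply, zero_smul]
    rw [h0, zero_conv, pairing]
    simp only [Pi.zero_apply, inner_zero_right, tsum_zero]
  rw [hsum, map_sum, ← Finset.sum_add_distrib]
  calc ∑ j, (pairing (conv (scal (y j)) (freqDeriv j G)) G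
          + conj (pairing (conv (scal (y j)) (freqDeriv j G)) G))
      = ∑ j, -pairing G (conv (scal (freqDeriv j (y j)) : (d → ℤ) → (V →L[ℂ] V)) G) :=
        Finset.sum_congr rfl fun j _ => by
          linear_combination pairing_conv_freqDeriv_eq (y j) (hy j) (hreal j) j hG
    _ = 0 := by rw [Finset.sum_neg_distrib, hdiv', neg_zero]

/-- The same identity read as `Re ⟨T_y G, G⟩ = 0`. -/
theorem re_pairing_transport_eq_zero (y : d → (d → ℤ) → ℂ) (hy : ∀ j, RapidDecay (y j))
    (hreal : ∀ j p, y j (-p) = conj (y j p)) (hdiv : ∑ j, freqDeriv j (y j) = 0)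
    {G : (d → ℤ) → V} (hG : eNormSq 1 G < ∞) :
    (pairing (∑ j, conv (scal (y j)) (freqDeriv j G)) G).re = 0 := by
  have h := pairing_transport_add_conj_eq_zero y hy hreal hdiv hG
  have h2 := Complex.add_conj (pairing (∑ j, conv (scal (y j)) (freqDeriv j G)) G)
  rw [h] at h2
  have h3 : ((2 * (pairing (∑ j, conv (scal (y j)) (freqDeriv j G)) G).re : ℝ) : ℂ) = 0 := by
    rw [Complex.ofReal_mul]; exact_mod_cast h2.symm
  have h4 : 2 * (pairing (∑ j, conv (scal (y j)) (freqDeriv j G)) G).re = 0 := by exact_mod_cast h3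
  linarith

end Skew


/-! ## §2 The transport form in `H²`: `|Re ⟨Λ² T_y u, Λ² u⟩| ≤ 6π (∑_j A₂(y_j)) ‖u‖₂²` -/

section TransportForm

variable {V : Type*} [NormedAddCommGroup V] [InnerProductSpace ℂ V] [CompleteSpace V]

omit [Fintype d] [CompleteSpace V] in
/-- Termwise convergence of the pairing is stable under finite sums in the left slot. -/
theorem summable_inner_finset_sum_left {ι : Type*} (F : Finset ι) {u : ι → (d → ℤ) → V}
    {v : (d → ℤ) → V} (h : ∀ i ∈ F, Summable fun k => ⟪u i k, v k⟫_ℂ) :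
    Summable fun k => ⟪(∑ i ∈ F, u i) k, v k⟫_ℂ := by
  refine (summable_sum (s := F) fun i hi => h i hi).congr fun k => ?_
  rw [Finset.sum_apply, sum_inner]

/-- **The transport form in `H²`** (the `htransport`-shaped input of condition (C2) for the R-β
chain, `GalerkinOneSidedLipschitz.galerkin_oneSided_uniform_transport`): for a rapidly decreasing,
real, divergence-free coefficient vector `y` and `u ∈ H³` (finiteness only; the bound is in `H²`),
with `T_y u = ∑_j y_j ⋆ ∂_j u` the coefficients of `(y·∇)u`,

  `|Re ⟨Λ² T_y u, Λ² u⟩| ≤ 6π · (∑_j A₂(y_j)) · ‖u‖₂²`,   `A₂(y_j) = ∑_p ⟨p⟩² |y_j(p)|`.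

Proof: `Λ² (y_j ⋆ ∂_j u) = y_j ⋆ ∂_j (Λ² u) + [Λ², y_j ⋆] ∂_j u`; the first terms pair to a purely
imaginary number by the skew identity (`re_pairing_transport_eq_zero` with `G = Λ² u ∈ H¹`), the
commutators are bounded by `eNorm_wmul_two_conv_sub_le` (`3 A₂(y_j) ‖∂_j u‖₁ ≤ 6π A₂(y_j) ‖u‖₂`)
and Cauchy–Schwarz `Lattice.norm_pairing_le`. Both signs are covered, so the sign convention of
the nonlinearity is immaterial. -/
theorem abs_re_pairing_wmul_two_transport_le (y : d → (d → ℤ) → ℂ) (hy : ∀ j, RapidDecay (y j))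
    (hreal : ∀ j p, y j (-p) = conj (y j p)) (hdiv : ∑ j, freqDeriv j (y j) = 0)
    {u : (d → ℤ) → V} (hu : eNormSq 3 u < ∞) :
    |(pairing (wmul 2 (∑ j, conv (scal (y j)) (freqDeriv j u))) (wmul 2 u)).re| ≤
      6 * Real.pi * (∑ j, (symbNorm 2 (scal (y j) : (d → ℤ) → (V →L[ℂ] V))).toReal) *
        (eNorm 2 u).toReal ^ 2 := by
  have ha : ∀ j, RapidDecay (scal (y j) : (d → ℤ) → (V →L[ℂ] V)) := fun j => (hy j).scal
  -- the advected family `G = Λ² u ∈ H¹`, and `u ∈ H²`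
  have hG1 : eNormSq 1 (wmul 2 u) < ∞ := by rw [eNormSq_wmul]; norm_num; exact hu
  have hG0 : eNormSq 0 (wmul 2 u) < ∞ := (eNormSq_mono zero_le_one _).trans_lt hG1
  have hG0' : eNormSq (-0) (wmul 2 u) < ∞ := by rw [neg_zero]; exact hG0
  have hu2 : eNormSq 2 u < ∞ := (eNormSq_mono (by norm_num : (2 : ℝ) ≤ 3) u).trans_lt hu
  have hut : Tempered u := ⟨3, hu⟩
  have hdu1 : ∀ j, eNormSq 1 (freqDeriv j u) < ∞ := fun j =>
    (eNormSq_freqDeriv_le 1 j u).trans_lt (ENNReal.mul_lt_top ENNReal.ofReal_lt_top (by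
      rw [show (1 : ℝ) + 1 = 2 by norm_num]; exact hu2))
  have hdG0 : ∀ j, eNormSq 0 (freqDeriv j (wmul 2 u)) < ∞ := fun j =>
    (eNormSq_freqDeriv_le 0 j _).trans_lt (ENNReal.mul_lt_top ENNReal.ofReal_lt_top (by
      rwa [zero_add]))
  -- the commutators `R j = Λ²(y_j ⋆ ∂_j u) − y_j ⋆ Λ²(∂_j u)`
  set R : d → (d → ℤ) → V := fun j =>
    wmul 2 (conv (scal (y j)) (freqDeriv j u)) - conv (scal (y j)) (wmul 2 (freqDeriv j u)) with hR
  have hRfin : ∀ j, eNormSq 0 (R j) < ∞ := fun j =>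
    (eNormSq_wmul_two_conv_sub_le (ha j) (hut.freqDeriv j)).trans_lt
      (ENNReal.mul_lt_top (by norm_num) (ENNReal.mul_lt_top
        (ENNReal.pow_lt_top (symbNorm_lt_top_of_rapidDecay (ha j) 2)) (hdu1 j)))
  -- decomposition `Λ² T = ∑_j y_j ⋆ ∂_j G + ∑_j R_j`
  have hdec : wmul 2 (∑ j, conv (scal (y j)) (freqDeriv j u)) =
      (∑ j, conv (scal (y j)) (freqDeriv j (wmul 2 u))) + ∑ j, R j := by
    rw [wmul_finset_sum, ← Finset.sum_add_distrib]
    refine Finset.sum_congr rfl fun j _ => ?_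
    rw [hR, ← wmul_freqDeriv]
    simp only
    abel
  -- summability of the two pairings
  have hsP : Summable fun k => ⟪(∑ j, conv (scal (y j)) (freqDeriv j (wmul 2 u))) k, wmul 2 u k⟫_ℂ :=
    summable_inner_finset_sum_left _ fun j _ =>
      summable_inner (eNormSq_conv_lt_top (ha j) (hdG0 j)) hG0'
  have hsR : ∀ j, Summable fun k => ⟪R j k, wmul 2 u k⟫_ℂ := fun j =>
    summable_inner (hRfin j) hG0'
  have hsplit : pairing (wmul 2 (∑ j, conv (scal (y j)) (freqDeriv j u))) (wmul 2 u) =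
      pairing (∑ j, conv (scal (y j)) (freqDeriv j (wmul 2 u))) (wmul 2 u)
        + ∑ j, pairing (R j) (wmul 2 u) := by
    rw [hdec, pairing_add_left hsP (summable_inner_finset_sum_left _ fun j _ => hsR j),
      pairing_finset_sum_left_of_summable _ fun j _ => hsR j]
  -- the skew part is purely imaginary
  have hskew := re_pairing_transport_eq_zero y hy hreal hdiv hG1
  -- each commutator pairing is bounded
  have hnorm2 : (eNorm (-0) (wmul 2 u)).toReal = (eNorm 2 u).toReal := by
    rw [neg_zero, eNorm_wmul, zero_add]
  have hRj : ∀ j, ‖pairing (R j) (wmul 2 u)‖ ≤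
      6 * Real.pi * (symbNorm 2 (scal (y j) : (d → ℤ) → (V →L[ℂ] V))).toReal *
        (eNorm 2 u).toReal ^ 2 := by
    intro j
    have hA : symbNorm 2 (scal (y j) : (d → ℤ) → (V →L[ℂ] V)) ≠ ∞ :=
      (symbNorm_lt_top_of_rapidDecay (ha j) 2).ne
    have hdu : eNorm 1 (freqDeriv j u) ≠ ∞ := (eNorm_lt_top_iff.2 (hdu1 j)).ne
    have h1 : (eNorm 0 (R j)).toReal ≤
        3 * (symbNorm 2 (scal (y j) : (d → ℤ) → (V →L[ℂ] V))).toReal *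
          (eNorm 1 (freqDeriv j u)).toReal := by
      have h := eNorm_wmul_two_conv_sub_le (ha j) (hut.freqDeriv j)
      have hfin : 3 * symbNorm 2 (scal (y j) : (d → ℤ) → (V →L[ℂ] V)) * eNorm 1 (freqDeriv j u) ≠ ∞ :=
        ENNReal.mul_ne_top (ENNReal.mul_ne_top (by norm_num) hA) hdu
      have := ENNReal.toReal_mono hfin h
      rwa [ENNReal.toReal_mul, ENNReal.toReal_mul, show (3 : ℝ≥0∞).toReal = 3 by norm_num] at this
    have h2 : (eNorm 1 (freqDeriv j u)).toReal ≤ 2 * Real.pi * (eNorm 2 u).toReal := by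
      have h := eNorm_freqDeriv_le 1 j u
      rw [show (1 : ℝ) + 1 = 2 by norm_num] at h
      have hfin : ENNReal.ofReal (2 * Real.pi) * eNorm 2 u ≠ ∞ :=
        ENNReal.mul_ne_top ENNReal.ofReal_ne_top (eNorm_lt_top_iff.2 hu2).ne
      have := ENNReal.toReal_mono hfin h
      rwa [ENNReal.toReal_mul, ENNReal.toReal_ofReal (by positivity)] at this
    have h0 : 0 ≤ (symbNorm 2 (scal (y j) : (d → ℤ) → (V →L[ℂ] V))).toReal := ENNReal.toReal_nonneg
    have hn0 : 0 ≤ (eNorm 2 u).toReal := ENNReal.toReal_nonneg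
    calc ‖pairing (R j) (wmul 2 u)‖ ≤ (eNorm 0 (R j)).toReal * (eNorm (-0) (wmul 2 u)).toReal :=
          norm_pairing_le (hRfin j) hG0'
      _ ≤ (3 * (symbNorm 2 (scal (y j) : (d → ℤ) → (V →L[ℂ] V))).toReal *
            (2 * Real.pi * (eNorm 2 u).toReal)) * (eNorm 2 u).toReal := by
          rw [hnorm2]
          exact mul_le_mul_of_nonneg_right (h1.trans (mul_le_mul_of_nonneg_left h2 (by positivity)))
            hn0
      _ = _ := by ring
  -- assemble
  rw [hsplit, Complex.add_re, hskew, zero_add, Complex.re_sum]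
  calc |∑ j, (pairing (R j) (wmul 2 u)).re| ≤ ∑ j, |(pairing (R j) (wmul 2 u)).re| :=
        Finset.abs_sum_le_sum_abs _ _
    _ ≤ ∑ j, 6 * Real.pi * (symbNorm 2 (scal (y j) : (d → ℤ) → (V →L[ℂ] V))).toReal *
          (eNorm 2 u).toReal ^ 2 :=
        Finset.sum_le_sum fun j _ => (Complex.abs_re_le_norm _).trans (hRj j)
    _ = _ := by rw [Finset.mul_sum, Finset.sum_mul]

/-- The same bound with `‖u‖₂²` written as `(eNormSq 2 u).toReal` (the squared `H²` norm, i.e. the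
squared norm of the scaled phase space `E` of the R-β chain, `HOME/instab/BETA2-SPEC.md` §1). -/
theorem abs_re_pairing_wmul_two_transport_le' (y : d → (d → ℤ) → ℂ) (hy : ∀ j, RapidDecay (y j))
    (hreal : ∀ j p, y j (-p) = conj (y j p)) (hdiv : ∑ j, freqDeriv j (y j) = 0)
    {u : (d → ℤ) → V} (hu : eNormSq 3 u < ∞) :
    |(pairing (wmul 2 (∑ j, conv (scal (y j)) (freqDeriv j u))) (wmul 2 u)).re| ≤
      6 * Real.pi * (∑ j, (symbNorm 2 (scal (y j) : (d → ℤ) → (V →L[ℂ] V))).toReal) *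
        (eNormSq 2 u).toReal := by
  rw [← toReal_eNorm_sq]
  exact abs_re_pairing_wmul_two_transport_le y hy hreal hdiv hu

end TransportForm



/-! ## §3 Modewise projections (the Leray symbol) drop out of the form and contract every `H^s` -/

section Projection

variable {V W' : Type*} [NormedAddCommGroup V] [InnerProductSpace ℂ V] [CompleteSpace V]
  [NormedAddCommGroup W']

omit [Fintype d] in
/-- **A modewise self-adjoint family fixing `v` drops out of the pairing against `v`**:
`⟨P u, v⟩ = ⟨u, v⟩` when `P(k)† = P(k)` and `P(k) v(k) = v(k)` for every mode (the Leray symbol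
`P(k) = 1 − k ⊗ k/|k|²` against a divergence-free `v`: the pairing `⟪ℙ T_y d, d⟫` of the R-β chain's
nonlinearity equals `⟪T_y d, d⟫`, to which §1–§2 apply). -/
theorem pairing_apply_eq_of_isSelfAdjoint (P : (d → ℤ) → (V →L[ℂ] V))
    (hsa : ∀ k, IsSelfAdjoint (P k)) (u v : (d → ℤ) → V) (hfix : ∀ k, P k (v k) = v k) :
    pairing (fun k => P k (u k)) v = pairing u v := by
  unfold pairing
  refine tsum_congr fun k => ?_
  rw [← ContinuousLinearMap.adjoint_inner_right, (hsa k).adjoint_eq, hfix]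

/-- **A modewise contraction does not increase any `H^s` norm**: `‖P u‖ₛ ≤ ‖u‖ₛ` when
`‖P(k)‖ ≤ 1` for every mode (the Leray symbol is an orthogonal projection, norm `≤ 1`; so the
first-slot bound of part I survives the projection). -/
theorem eNormSq_apply_le_of_opNorm_le_one {X : Type*} [NormedAddCommGroup X] [NormedSpace ℂ X]
    [NormedSpace ℂ W'] (P : (d → ℤ) → (X →L[ℂ] W')) (hP : ∀ k, ‖P k‖ ≤ 1) (s : ℝ)
    (u : (d → ℤ) → X) : eNormSq s (fun k => P k (u k)) ≤ eNormSq s u :=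
  eNormSq_le_of_norm_le_norm fun k =>
    ((P k).le_opNorm (u k)).trans (mul_le_of_le_one_left (norm_nonneg _) (hP k))

end Projection

end Summit.NavierStokesRegularity.FluidComputer.TransportSkewLattice

end
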